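/-
Copyright (c) 2026. All rights reserved.
Released under Apache 2.0 license as described in the file LICENSE.
Authors: abc-iut cell, statement-typer seat abc-iut-L4-t3 (wave 1; gen 7).
-/
import Literature.AnabelianGeometry.AbsoluteAnabelian.Ltimes.LogFrobeniusMonoTelecoreCoherence
import Literature.AnabelianGeometry.AbsoluteAnabelian.LogFrobeniusIotaAnMono
import HarnessLib

/-!
# [AbsTopIII] Proposition 5.8 (vii), interface add-on: the natural transformations `ι^{An⊢⊞}_{w,ε}` for the edges of `Γ⃗×_w`

S. Mochizuki, *Topics in absolute anabelian geometry III: global reconstruction algorithms*,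
J. Math. Sci. Univ. Tokyo 22 (2015) 939–1156 [MochizukiAbsTopIII2015]; locators `p.N` = pages of the author's
manuscript (`paper:url-5493eb38cbb7`), read on the page (own render `p0141.txt` l. 37 – `p0142.txt` l. 14): Prop 5.8
(vii) p. 142 l. 1–6 ("… together with a 'forgetful functor' `ψ^{An⊢⊞}_{w,ν} : An⊢[𝒩⊢⊞_w] → 𝒩⊢⊞_w` … for each vertex `ν` of
`Γ⃗×_w := Γ⃗×_non` (respectively, `Γ⃗×_w := Γ⃗×_arc`), and a natural transformation `ι^{An⊢⊞}_{w,ε} : ψ^{An⊢⊞}_{w,ν₁} → ψ^{An⊢⊞}_{w,ν₂}`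
for each edge `ε` of `Γ⃗×_w` running from a vertex `ν₁` to a vertex `ν₂`"); Def 5.4 (iii) p. 126 / (v) p. 127 (`Γ⃗×_non`,
`Γ⃗×_arc` as the intersections `Γ⃗^⋉ ∩ Γ⃗^⋊`); Cor 5.10 (iv)(c) p. 148 l. 41–49 (the contact structure `ℋ_{An⊢}` is
generated by `η⊢_{v,ν}`, `(η⊢_{v,ν})⁻¹`, the mono-analyticization homotopies "and the homotopies on `D_{An⊢}` arising from
the `ι^{An⊢⊞}_{v,ε}`").

WHY THIS FILE (interface ADD-ON, successor never in place; the FROZEN `LogFrobeniusCompatibility.lean` is NOT edited; same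
doctrine as `IotaOver` / `LamOverLink` / `MonoAnalyticizationHomotopies` / `MonoTelecoreCoherence` of this lineage).  The
interface `LogFrobeniusSetting` records the forgetful functors `ψAnMono w ν` of Prop 5.8 (vii) for the vertices of `Γ⃗×_w`
but NOT the printed natural transformations `ι^{An⊢⊞}_{w,ε}` for its edges (non-author count-read of node Prop 5.8 (vii),
2026-08-26: clause [d] "carried by no field of the setting term").  Consequently the typed Cor 5.10 (iv)(b)(c) rows
(`Cor510MonoTelecore`, `Cor510MonoTelecorePinned`) cannot even mention the `ι^{An⊢⊞}`-generators of `ℋ_{An⊢}` that print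
lists.  This file supplies the DATA, assumption-free, over the (c)-datum "`ψ` lies over `ℰ⊢`" of the coherence add-on:

* `LogEdgeTS.InCore` — the edges of `Γ⃗×_v` among all edges of `Γ⃗^log_v` (`NonarchEdge.InCore` / `ArchEdge.InCore` of the
  frozen graphs), with `InCore.isCross_src/_tgt` (its endpoints are vertices of `Γ⃗×_v`, where `ψ^{An⊢⊞}` is defined);
* `LogFrobeniusSetting.IotaAnMono hψ` — for every `w` and every edge `ε : ν₁ → ν₂` of `Γ⃗×_w` a natural transformation
  `ι w ε hε : ψAnMono w ν₁ ⟶ ψAnMono w ν₂`, subject to `ι_over`: "morphisms induced by `Th⊢[Z]`" — the image of `ι^{An⊢⊞}_{w,ε,X}`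
  under `𝒩⊢⊞_w → 𝒩⊢_w → ℰ⊢` is the IDENTITY of the underlying object of `Th⊢[Z]`, read through the isomorphisms `hψ` ("`ψ_ν`
  lies over `ℰ⊢`", the `psiOver` field of `MonoTelecoreCoherence`, or any other witness);
* NON-VACUITY AT THE GENUINE MODEL: over abc-iut-w6-d036's genuine containers (`MLFGaloisMonoAnabelianContainers`,
  `LogFrobeniusMonoGenuineProp58vii`), `MLFClosure.ιMono` = `ι^{An⊢⊞}_{w,ε}` for ALL four edges of `Γ⃗×_non` — `𝒪^× ↪ k̄^×` and
  `k~ ↪ (k̄^×)^pf` the genuine inclusion `kbarUnitsToTimes`, the two perfection arrows `𝒪^× → k~`, `k̄^× → (k̄^×)^pf` the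
  IDENTITY under that file's source representation of the perfection vertices (HONEST LIMIT inherited, stated), the
  archimedean shell-arrow the identity (no archimedean component there) — extending its `ιMonoUnitsToMult`
  (`ιMono_unitsToMult`); and `nonarchGenuineMonoAn_iotaAnMono : (nonarchGenuineMonoAn p Vmod isArc).IotaAnMono _` with
  `hψ` the identity isomorphisms (`ψ` lies over `ℰ⊢` ON THE NOSE there, `nonarchGenuineMonoAn_ψOver`).

NOT HERE (successor rows, on a lead's GO only): the compatibility square of `ι^{An⊢⊞}_{v,ε}` with `η⊢_{v,ν₁}`, `η⊢_{v,ν₂}` and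
the mono-analyticised `ι⊞_{v,ε}` ("`η⊢` natural along `ε`"), and the strengthened pinned row of Cor 5.10 (iv)(c) whose contact
structure contains the `ι^{An⊢⊞}`-generators.  ASSUMPTION-FREE typing of printed DATA; refereed pre-IUT material; nothing
here bears on [IUTchIII] Cor. 3.12; OUR kernel typing, no side taken; typed ≠ proved.

**`⋉`-TWIN (cell row «LTIMES-SUCCESSOR», L4-lead m162; typing finding T3g9-F1).**  This file is the verbatim
re-elaboration of `LogFrobeniusIotaAnMono.lean` over the successor interface `LogFrobeniusSettingLtimes`
(`Ltimes/LogFrobeniusCompatibility.lean`: `ι⊞_{v,ε}` indexed by the edges of `Γ⃗^⋉_v` at EVERY place, [AbsTopIII] Cor 5.5 (iii)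
p. 131), produced by the cell recipe `LTIMES-RECIPE.md`: names carry over inside `namespace LogFrobeniusSettingLtimes`, the
section variable is `Lt`, setting-independent declarations are NOT repeated (the originals are in scope), statements and
proofs are otherwise unchanged.  The original file over the frozen interface stays as it is.
-/

set_option autoImplicit false

universe u

open CategoryTheory

namespace Literature.AnabelianGeometry.AbsoluteAnabelian

/-! (The edges of `Γ⃗×_v`, `LogEdgeTS.InCore`, and their endpoint facts are the frozen file's, reused.) -/

namespace LogFrobeniusSettingLtimes

variable {Vmod : Type u} {isArc : Vmod → Bool} (Lt : LogFrobeniusSettingLtimes Vmod isArc)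

/-! ## The add-on -/

/-- **INTERFACE ADD-ON (Prop 5.8 (vii), the natural transformations `ι^{An⊢⊞}_{w,ε}`).**  Over a setting `L` and a witness
`hψ` that every `ψ^{An⊢⊞}_{w,ν}` lies over `ℰ⊢ = Th⊢[Z]` (the (c)-datum; e.g. `MonoTelecoreCoherence.psiOver`):
* `ι w ε hε` — for every `w ∈ V(F_mod)` and every edge `ε : ν₁ → ν₂` of `Γ⃗×_w`, "a natural transformation
  `ι^{An⊢⊞}_{w,ε} : ψ^{An⊢⊞}_{w,ν₁} → ψ^{An⊢⊞}_{w,ν₂}`";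
* `ι_over` — "morphisms induced by `Th⊢[Z]`": at every object `X` of `An⊢[𝒩⊢⊞]`, the image of `ι^{An⊢⊞}_{w,ε,X}` under
  `𝒩⊢⊞_w → 𝒩⊢_w → ℰ⊢` is the identity of the underlying object of `Th⊢[Z]`, read through `hψ`.
[cite: MochizukiAbsTopIII2015, Prop 5.8 (vii) p. 142] -/
structure IotaAnMono (hψ : ∀ (w : Vmod) (j : {ν : LogVertex (isArc w) // ν.IsCross}),
    Lt.ψAnMono w j ⋙ Lt.forgetMono w ⋙ Lt.toEmono w ≅ Lt.κAnMono.inverse) : Type (u + 1) where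
  /-- `ι^{An⊢⊞}_{w,ε} : ψ^{An⊢⊞}_{w,ν₁} → ψ^{An⊢⊞}_{w,ν₂}` for each edge `ε : ν₁ → ν₂` of `Γ⃗×_w`. -/
  ι : ∀ (w : Vmod) {ν₁ ν₂ : LogVertex (isArc w)} (ε : LogEdgeTS (isArc w) ν₁ ν₂) (hε : ε.InCore),
    Lt.ψAnMono w ⟨ν₁, hε.isCross_src⟩ ⟶ Lt.ψAnMono w ⟨ν₂, hε.isCross_tgt⟩
  /-- `ι^{An⊢⊞}_{w,ε}` lies over the identity of `Th⊢[Z]`. -/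
  ι_over : ∀ (w : Vmod) {ν₁ ν₂ : LogVertex (isArc w)} (ε : LogEdgeTS (isArc w) ν₁ ν₂) (hε : ε.InCore) (X : Lt.AnMono),
    (Lt.toEmono w).map ((Lt.forgetMono w).map ((ι w ε hε).app X)) =
      (hψ w ⟨ν₁, hε.isCross_src⟩).hom.app X ≫ (hψ w ⟨ν₂, hε.isCross_tgt⟩).inv.app X

namespace IotaAnMono

variable {Lt}
variable {hψ : ∀ (w : Vmod) (j : {ν : LogVertex (isArc w) // ν.IsCross}),
  Lt.ψAnMono w j ⋙ Lt.forgetMono w ⋙ Lt.toEmono w ≅ Lt.κAnMono.inverse}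
variable (I : Lt.IotaAnMono hψ)

/-- `ι^{An⊢⊞}_{w,ε}` pushed down to `𝒩⊢_w` (the `ι^{An⊢}_{w,ε}` of print's "omit the symbol ⊞" convention, Prop 5.8 (vii), last
paragraph). [cite: MochizukiAbsTopIII2015, Prop 5.8 (vii) p. 142] -/
def ιN (w : Vmod) {ν₁ ν₂ : LogVertex (isArc w)} (ε : LogEdgeTS (isArc w) ν₁ ν₂) (hε : ε.InCore) :
    Lt.ψAnMono w ⟨ν₁, hε.isCross_src⟩ ⋙ Lt.forgetMono w ⟶ Lt.ψAnMono w ⟨ν₂, hε.isCross_tgt⟩ ⋙ Lt.forgetMono w :=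
  Functor.whiskerRight (I.ι w ε hε) (Lt.forgetMono w)

/-- Over `Th⊢[Z]` the pushed-down `ι^{An⊢}_{w,ε}` is again the identity read through `hψ` (restatement of `ι_over`).
[cite: MochizukiAbsTopIII2015, Prop 5.8 (vii) p. 142] -/
theorem toEmono_map_ιN_app (w : Vmod) {ν₁ ν₂ : LogVertex (isArc w)} (ε : LogEdgeTS (isArc w) ν₁ ν₂) (hε : ε.InCore)
    (X : Lt.AnMono) :
    (Lt.toEmono w).map ((I.ιN w ε hε).app X) =
      (hψ w ⟨ν₁, hε.isCross_src⟩).hom.app X ≫ (hψ w ⟨ν₂, hε.isCross_tgt⟩).inv.app X :=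
  I.ι_over w ε hε X

/-- In particular the image of `ι^{An⊢⊞}_{w,ε,X}` in `Th⊢[Z]` is an ISOMORPHISM (it is a composite of components of
isomorphisms) — "induced by `Th⊢[Z]`", a groupoid in print. [cite: MochizukiAbsTopIII2015, Prop 5.8 (vii) p. 142] -/
theorem isIso_toEmono_map_ι_app (w : Vmod) {ν₁ ν₂ : LogVertex (isArc w)} (ε : LogEdgeTS (isArc w) ν₁ ν₂)
    (hε : ε.InCore) (X : Lt.AnMono) :
    IsIso ((Lt.toEmono w).map ((Lt.forgetMono w).map ((I.ι w ε hε).app X))) := by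
  rw [I.ι_over w ε hε X]
  exact inferInstanceAs
    (IsIso ((hψ w ⟨ν₁, hε.isCross_src⟩).app X ≪≫ ((hψ w ⟨ν₂, hε.isCross_tgt⟩).app X).symm).hom)

end IotaAnMono

/-- The (c)-datum of a `MonoTelecoreCoherence` is a legitimate `hψ` for the add-on: `IotaAnMono` over
`K.psiOver` is the type of `ι^{An⊢⊞}`-data compatible with the coherence add-on of Cor 5.10 (iv)(b)(c).
[cite: MochizukiAbsTopIII2015, Cor 5.10 (iv)(c) p. 148] -/
abbrev MonoTelecoreCoherence.IotaData {M : Lt.MonoAnalyticizationHomotopies} (K : Lt.MonoTelecoreCoherence M) :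
    Type (u + 1) :=
  Lt.IotaAnMono K.psiOver

end LogFrobeniusSettingLtimes

/-! (Non-vacuity: the frozen file's genuine nonarchimedean instance `nonarchGenuineMonoAn_iotaAnMono` transfers to the
`⋉`-carrier `(nonarchGenuineMonoAn p Vmod isArc).toLtimes` field by field; the genuine archimedean instance is the cell's row S3.) -/

end Literature.AnabelianGeometry.AbsoluteAnabelian
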